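/-
Copyright (c) 2026 the pub-hodgecm-mathlib formalisation cell (harness21).  Prover seat hodgecm-mathlib-LH4-p09 (g9), req620 Track A «(D-RAM) FOUR-FRAME» squad
(STAGE-1b, the (β-BAL) TABLE of `stub_law_cleanSgn`; dealer∕pen LH4-plan (g13) WORD #110 «THE PRODUCT TRANSVERSAL» (κG lineage) for LH4-p13 (g8)'s ★ p860847 and
LH4-p05 (g8)'s TABLE assembly; SIG `SIG-ProductTransversal.v1` 8e8be83d), 2026-09-04.  FILE 2 of 2.
-/
import Summits.HodgeConjecture.HodgeConjecture.Theorems.F0P3cDyRamGluedDeepRatioSubgroup   -- FILE 1 (this seat): §0 valuation helpers (`v_T_sub_one_le`, `v_T_sub_T_le`, …), §1 the deep ratio subgroup `D`; brings ★ κG §4, ★ DEFS `…DiagonalTorusDefs`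
import HarnessLib

/-!
# Crux `H413`, line LH4 «(D-RAM) FOUR-FRAME» — STAGE-1b, the (β-BAL) TABLE: «THE PRODUCT TRANSVERSAL OF THE GLUED REPRESENTATIVE» (FILE 2 of 2) — a product transversal
# `R₀ = A₀ × A_β × A_γ` of `S_F(latt V(1,1,g)) ∕ N₀`, `N₀ = N(D)` the product norm subgroup of FILE 1, in the Finset ∃!-currency of ★ p860847 (`hR₀S`, `hR₀`), and `#R₀`

Cell `hodgecm-mathlib` (D-0151), FLOOR 0, crux item H413 = `stmt-HodgeConjecture-24833`, route of record `HCCMUnconditional`; squad F0∕P3c∕LH4; lane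
`--supports stmt-HodgeConjecture-24833 --as helper` (count-neutral; pays NO tier-0 row).  THEOREMS ONLY (no `def`, no instance, no notation, no `sorry`, default heartbeats).
DATUM-FREE valuation algebra (`K : Type` with `Valued K ℤᵐ⁰`, `σ : K →+* K` isometric, `0 < |ϖ| < 1`, `1 ≤ ρ`; no residue field, no `|2|`, no self-duality).

WHY (MEMO-B2b2 65e7cd47 §3 «the cheap way round the shear»).  In the multiplicative coordinates `(x, p, y) = (u₀, u₁∕u₀, u₂∕u₁)` — three characters, so no cocycle — ★ κG §4
`mem_fixedUnitStabilizer_glued_rep_iff` reads `S_F(latt V) = {x ∈ U_F, y ∈ U_F^{[ρ+2t]}, p·T(y) ∈ U_F^{[2ρ]}}` with the unit `T(y) = y + g⁻¹(y − 1)` (MEMO §1 with `1 + e = y`,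
`w = p·T(y)`), and the product norm subgroup of FILE 1 is `N₀ = N(U_E) × N(U_E^{[2ρ]}) × N(U_E^{[2ρ+2t]})`.  Hence a transversal of `S_F ∕ N₀` is obtained from three F-side
representative systems by MEMO §3's parametrisation `r = a₀·(1, ψ, ψ·aβ)`, `ψ = aγ·T(aβ)⁻¹`:
* §1 `productTransversal_glued_rep` — for ∃!-systems `A₀` (of `U_F ∕ N(U_E)`), `Aβ` (of `U_F^{[ρ+2t]} ∕ N(U_E^{[2ρ+2t]})` — the DEEP quotient, more terms than MEMO's (β), paid
  back by `[N′ : N₀]` in ★ p860847), `Aγ` (of `U_F^{[2ρ]} ∕ N(U_E^{[2ρ]})`) and the Finset `R₀` of all `a₀·(1, ψ, ψ·aβ)`: `R₀ ⊆ S_F(latt V)` and every `u ∈ S_F(latt V)` has a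
  UNIQUE `r ∈ R₀` with `u⁻¹·r ∈ N₀ = D.map (unitNormMap σ 3)` — ★ p860847's `hR₀S` and `hR₀` on the nose.  (Existence: represent `x`, then `y` — which moves the corner letter
  `p·T(y) ∈ U^{[2ρ]}` to `p·T(aβ) ∈ U^{[2ρ]}` since `T` is `|ϖ|^{−2t}`-Lipschitz and `|aβ − y| ≤ |ϖ|^{2ρ+2t}` — then `p·T(aβ)`; uniqueness: the three ∃!'s read on the coordinates
  `0`, `2∕1`, `1∕0` of `u⁻¹·r`.)
* §2 `exists_productTransversal` — such an `R₀` exists, of cardinality `#A₀·#Aβ·#Aγ` (`Finset.image` of the product; the parametrisation is injective).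
The index `[𝒰 : N₀]` the TABLE divides by is the product `[U_F : N U_E]·[U_F : N U_E^{[2ρ]}]·[U_F : N U_E^{[2ρ+2t]}]` in the same coordinates (sequel, on the assembler's letter).
HONEST LABEL.  Count-neutral valuation∕group bookkeeping; nothing printed is asserted; no census law is stated; (β-BAL), (β), β₂ and the T₊ row stay OPEN; `HC_CM` is proved only
modulo the 7 printed citations (2 remaining named inputs: hLiu418 = `stmt-HodgeConjecture-24832`, h413 = `stmt-HodgeConjecture-24833`) until rung 0 closes.
## References
* [Kottwitz1986BaseChangeUnits] R. E. Kottwitz, *Base change for unit elements of Hecke algebras*, Compositio Math. 60 (1986): §1 pp. 240–241 (orbital integrals as weighted lattice counts).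
* [Serre1979] J.-P. Serre, *Local Fields*, GTM 67 (1979): Ch. V §2–§3 (norm groups of the unit filtration of a quadratic extension; index two on the fixed units).
* [Rogawski1990] J. D. Rogawski, *Automorphic Representations of Unitary Groups in Three Variables*, Ann. of Math. Stud. 123 (1990): §4.9 Prop. 4.9.1 (b) p. 55.
-/

set_option autoImplicit false

noncomputable section

namespace Summit.HodgeConjecture.HodgeConjecture.Cruxes.H413.F0P3cDyRamGluedProductTransversal

open Matrix
open Literature.NumberTheory.Automorphic Literature.NumberTheory.Automorphic.HermitianLattice Literature.NumberTheory.Automorphic.UnitaryGroup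
open Literature.NumberTheory.Automorphic.UnitaryLatticeTree Literature.NumberTheory.Automorphic.UnitaryThreeFourFrame
open Summit.HodgeConjecture.HodgeConjecture.Cruxes.H413.F0P3cDyRamDiagonalTorusDefs
open Summit.HodgeConjecture.HodgeConjecture.Cruxes.H413.F0P3cDyRamDiagonalKappaGluedClass (mem_fixedUnitStabilizer_glued_rep_iff)
open Summit.HodgeConjecture.HodgeConjecture.Cruxes.H413.F0P3cDyRamGluedDeepRatioSubgroup
open scoped Valued WithZero Matrix MatrixGroups

variable {K : Type} [Field K] [Valued K ℤᵐ⁰]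

/-! ## §1 The product transversal `R₀ = A₀ × A_β × A_γ` of `S_F(latt V) ∕ N₀` -/

/-- **(PT-3) THE PRODUCT TRANSVERSAL** (★ p860847's `hR₀S` and `hR₀` for the product norm subgroup `N₀ = N(D)`).  Frame: `σ` an isometric involution, `0 < |ϖ| < 1`, `1 ≤ ρ`, the glued
representative `V(1,1,g)` (`|g| = |ϖ|^{2t}`, `σg = g`), the deep ratio subgroup `D` of §1.  DATA: three F-side representative systems — `A₀ ⊆ U_F` for `U_F ∕ N(U_E)`
(`hA₀ : ∀ x ∈ U_F, ∃! a ∈ A₀, a∕x ∈ N(U_E)`), `Aβ ⊆ U_F^{[ρ+2t]}` for `U_F^{[ρ+2t]} ∕ N(U_E^{[2ρ+2t]})`, `Aγ ⊆ U_F^{[2ρ]}` for `U_F^{[2ρ]} ∕ N(U_E^{[2ρ]})` (norm witnesses as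
`∃ e, |e| = 1 ∧ eσe = a∕x` ∕ `∃ s, |s − 1| ≤ |ϖ|^{2ρ+2t} ∧ sσs = a∕y` ∕ `∃ w, |w − 1| ≤ |ϖ|^{2ρ} ∧ wσw = a∕p`) — and the Finset `R₀` of all `a₀·(1, ψ, ψ·aβ)`,
`ψ = aγ·(aβ + g⁻¹(aβ − 1))⁻¹` (MEMO-B2b2 65e7cd47 §3's `r = a₀(1, ψ, ψ(1+e))`).  THEN `R₀ ⊆ S_F(latt V)` and every `u ∈ S_F(latt V)` has a UNIQUE `r ∈ R₀` with
`u⁻¹·r ∈ N₀ = D.map (unitNormMap σ 3)`.  In the coordinates `(x, p, y) = (u₀, u₁∕u₀, u₂∕u₁)`: represent `x` by `a₀`, `y` by `aβ` (this moves the corner letter `p·T(y) ∈ U^{[2ρ]}`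
to `p·T(aβ) ∈ U^{[2ρ]}`, `T` being `|ϖ|^{−2t}`-Lipschitz), then `p·T(aβ)` by `aγ`; uniqueness reads the three ∃!'s on the coordinates `0`, `2∕1`, `1∕0` of `u⁻¹·r`.
[cite: Kottwitz1986BaseChangeUnits, §1 pp. 240–241] [cite: Serre1979, Ch. V §3] [cite: Rogawski1990, §4.9 Prop. 4.9.1 (b) p. 55] -/
theorem productTransversal_glued_rep {σ : K →+* K} (hvσ : ∀ a, Valued.v (σ a) = Valued.v a)
    {ϖ : K} (hϖ0 : ϖ ≠ 0) (hϖ1 : Valued.v ϖ < 1) {ρ t : ℕ} (hρ : 1 ≤ ρ) {g : K} (hσg : σ g = g) (hg : Valued.v g = Valued.v ϖ ^ (2 * t))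
    (V : GL (Fin 3) K) (hV : (V : Matrix (Fin 3) (Fin 3) K) = !![1, 0, 0; 1, ϖ ^ ρ, 0; 1 * 1 + g, ϖ ^ ρ * 1, ϖ ^ (2 * ρ + 2 * t)])
    {D : Subgroup (Fin 3 → Kˣ)} (hD : ∀ s : Fin 3 → Kˣ, s ∈ D ↔
      (∀ i, Valued.v (s i : K) = 1) ∧ Valued.v ((s 1 : K) - s 0) ≤ Valued.v ϖ ^ (2 * ρ) ∧ Valued.v ((s 2 : K) - s 1) ≤ Valued.v ϖ ^ (2 * ρ + 2 * t))
    (A₀ Aβ Aγ : Finset K)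
    (hA₀sub : ∀ a ∈ A₀, σ a = a ∧ Valued.v a = 1)
    (hA₀ : ∀ x : K, σ x = x → Valued.v x = 1 → ∃! a, a ∈ A₀ ∧ ∃ e : K, Valued.v e = 1 ∧ e * σ e = a / x)
    (hAγsub : ∀ a ∈ Aγ, σ a = a ∧ Valued.v (a - 1) ≤ Valued.v ϖ ^ (2 * ρ))
    (hAγ : ∀ p : K, σ p = p → Valued.v (p - 1) ≤ Valued.v ϖ ^ (2 * ρ) →
      ∃! a, a ∈ Aγ ∧ ∃ w : K, Valued.v (w - 1) ≤ Valued.v ϖ ^ (2 * ρ) ∧ w * σ w = a / p)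
    (hAβsub : ∀ a ∈ Aβ, σ a = a ∧ Valued.v (a - 1) ≤ Valued.v ϖ ^ (ρ + 2 * t))
    (hAβ : ∀ y : K, σ y = y → Valued.v (y - 1) ≤ Valued.v ϖ ^ (ρ + 2 * t) →
      ∃! a, a ∈ Aβ ∧ ∃ s : K, Valued.v (s - 1) ≤ Valued.v ϖ ^ (2 * ρ + 2 * t) ∧ s * σ s = a / y)
    (R₀ : Finset (Fin 3 → Kˣ))
    (hR₀ : ∀ r : Fin 3 → Kˣ, r ∈ R₀ ↔ ∃ a₀ ∈ A₀, ∃ aβ ∈ Aβ, ∃ aγ ∈ Aγ,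
      (r 0 : K) = a₀ ∧ (r 1 : K) = a₀ * (aγ * (aβ + g⁻¹ * (aβ - 1))⁻¹) ∧ (r 2 : K) = a₀ * (aγ * (aβ + g⁻¹ * (aβ - 1))⁻¹) * aβ) :
    (∀ r ∈ R₀, r ∈ fixedUnitStabilizer σ (latt (V : Matrix (Fin 3) (Fin 3) K))) ∧
      ∀ u ∈ fixedUnitStabilizer σ (latt (V : Matrix (Fin 3) (Fin 3) K)), ∃! r, r ∈ R₀ ∧ u⁻¹ * r ∈ D.map (unitNormMap σ 3) := by
  -- bookkeeping
  have hvϖ : 0 < Valued.v ϖ := (Valuation.pos_iff _).2 hϖ0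
  have hϖ1' : Valued.v ϖ ≤ 1 := hϖ1.le
  have hg0 : g ≠ 0 := fun h0 => by rw [h0, map_zero] at hg; exact (pow_ne_zero _ hvϖ.ne') hg.symm
  have hρlt : Valued.v ϖ ^ ρ < 1 := v_pow_lt_one hϖ1 (by omega)
  have h2ρlt : Valued.v ϖ ^ (2 * ρ) < 1 := v_pow_lt_one hϖ1 (by omega)
  have hρ2tlt : Valued.v ϖ ^ (ρ + 2 * t) < 1 := v_pow_lt_one hϖ1 (by omega)
  have h2ρ2tlt : Valued.v ϖ ^ (2 * ρ + 2 * t) < 1 := v_pow_lt_one hϖ1 (by omega)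
  -- the three systems consist of `σ`-fixed units; `T(aβ)` is a `σ`-fixed unit
  have hAγ1 : ∀ a ∈ Aγ, Valued.v a = 1 := fun a ha => v_eq_one_of_v_sub_one_lt_one ((hAγsub a ha).2.trans_lt h2ρlt)
  have hAβ1 : ∀ a ∈ Aβ, Valued.v a = 1 := fun a ha => v_eq_one_of_v_sub_one_lt_one ((hAβsub a ha).2.trans_lt hρ2tlt)
  have hT1 : ∀ a ∈ Aβ, Valued.v (a + g⁻¹ * (a - 1)) = 1 := fun a ha =>
    v_eq_one_of_v_sub_one_lt_one ((v_T_sub_one_le hϖ0 hϖ1' ρ t hg (hAβsub a ha).2).trans_lt hρlt)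
  have hT0 : ∀ a ∈ Aβ, a + g⁻¹ * (a - 1) ≠ 0 := fun a ha h0 => by
    have := hT1 a ha; rw [h0, map_zero] at this; exact zero_ne_one this
  have hTσ : ∀ a ∈ Aβ, σ (a + g⁻¹ * (a - 1)) = a + g⁻¹ * (a - 1) := fun a ha => by
    rw [map_add, map_mul, map_inv₀, map_sub, map_one, hσg, (hAβsub a ha).1]
  have hTg : ∀ a ∈ Aβ, a * g + (a - 1) ≠ 0 := fun a ha h0 => hT0 a ha (by
    rw [show a + g⁻¹ * (a - 1) = (a * g + (a - 1)) / g by field_simp, h0, zero_div])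
  have hA₀0 : ∀ a ∈ A₀, a ≠ 0 := fun a ha h0 => by
    have := (hA₀sub a ha).2; rw [h0, map_zero] at this; exact zero_ne_one this
  have hAγ0 : ∀ a ∈ Aγ, a ≠ 0 := fun a ha h0 => by
    have := hAγ1 a ha; rw [h0, map_zero] at this; exact zero_ne_one this
  have hAβ0 : ∀ a ∈ Aβ, a ≠ 0 := fun a ha h0 => by
    have := hAβ1 a ha; rw [h0, map_zero] at this; exact zero_ne_one this
  -- `ψ = aγ·T(aβ)⁻¹` is a `σ`-fixed unit
  have hψ1 : ∀ aβ ∈ Aβ, ∀ aγ ∈ Aγ, Valued.v (aγ * (aβ + g⁻¹ * (aβ - 1))⁻¹) = 1 := fun aβ haβ aγ haγ => by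
    rw [map_mul, map_inv₀, hAγ1 aγ haγ, hT1 aβ haβ, inv_one, mul_one]
  have hψσ : ∀ aβ ∈ Aβ, ∀ aγ ∈ Aγ, σ (aγ * (aβ + g⁻¹ * (aβ - 1))⁻¹) = aγ * (aβ + g⁻¹ * (aβ - 1))⁻¹ := fun aβ haβ aγ haγ => by
    rw [map_mul, map_inv₀, (hAγsub aγ haγ).1, hTσ aβ haβ]
  constructor
  · -- (i) `R₀ ⊆ S_F(latt V)`
    intro r hr
    obtain ⟨a₀, ha₀, aβ, haβ, aγ, haγ, hr0, hr1, hr2⟩ := (hR₀ r).1 hr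
    have hru : r ∈ fixedUnitTorus σ 3 := by
      rw [mem_fixedUnitTorus_iff]
      refine ⟨fun i => ?_, fun i => ?_⟩
      · fin_cases i
        · show Valued.v ((r 0 : Kˣ) : K) = 1
          rw [hr0]; exact (hA₀sub a₀ ha₀).2
        · show Valued.v ((r 1 : Kˣ) : K) = 1
          rw [hr1, map_mul, (hA₀sub a₀ ha₀).2, hψ1 aβ haβ aγ haγ, mul_one]
        · show Valued.v ((r 2 : Kˣ) : K) = 1
          rw [hr2, map_mul, map_mul, (hA₀sub a₀ ha₀).2, hψ1 aβ haβ aγ haγ, hAβ1 aβ haβ, mul_one, mul_one]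
      · fin_cases i
        · show σ ((r 0 : Kˣ) : K) = r 0
          rw [hr0]; exact (hA₀sub a₀ ha₀).1
        · show σ ((r 1 : Kˣ) : K) = r 1
          rw [hr1, map_mul, (hA₀sub a₀ ha₀).1, hψσ aβ haβ aγ haγ]
        · show σ ((r 2 : Kˣ) : K) = r 2
          rw [hr2, map_mul, map_mul, (hA₀sub a₀ ha₀).1, hψσ aβ haβ aγ haγ, (hAβsub aβ haβ).1]
    rw [mem_fixedUnitStabilizer_glued_rep_iff hϖ0 hϖ1' ρ t hg V hV hru]
    constructor
    · have e : ((r 2 : Kˣ) : K) - r 1 = a₀ * (aγ * (aβ + g⁻¹ * (aβ - 1))⁻¹) * (aβ - 1) := by rw [hr2, hr1]; ring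
      rw [e, map_mul, map_mul, (hA₀sub a₀ ha₀).2, hψ1 aβ haβ aγ haγ, one_mul, one_mul]
      exact (hAβsub aβ haβ).2
    · have hψT : aγ * (aβ + g⁻¹ * (aβ - 1))⁻¹ * (aβ + g⁻¹ * (aβ - 1)) = aγ := by
        rw [mul_assoc, inv_mul_cancel₀ (hT0 aβ haβ), mul_one]
      have e : g⁻¹ * (((r 2 : Kˣ) : K) - r 1) + (((r 2 : Kˣ) : K) - r 0) = a₀ * (aγ - 1) := by
        rw [hr2, hr1, hr0, show g⁻¹ * (a₀ * (aγ * (aβ + g⁻¹ * (aβ - 1))⁻¹) * aβ - a₀ * (aγ * (aβ + g⁻¹ * (aβ - 1))⁻¹)) +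
            (a₀ * (aγ * (aβ + g⁻¹ * (aβ - 1))⁻¹) * aβ - a₀) = a₀ * (aγ * (aβ + g⁻¹ * (aβ - 1))⁻¹ * (aβ + g⁻¹ * (aβ - 1)) - 1) by ring, hψT]
      rw [e, map_mul, (hA₀sub a₀ ha₀).2, one_mul]
      exact (hAγsub aγ haγ).2
  · -- (ii) every `u ∈ S_F(latt V)` has a unique representative
    intro u hu
    obtain ⟨-, hu1, hu2⟩ := (mem_fixedUnitStabilizer_iff σ _ u).1 hu
    have huT : u ∈ fixedUnitTorus σ 3 := (mem_fixedUnitTorus_iff σ u).2 ⟨hu1, hu2⟩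
    obtain ⟨hb, hc⟩ := (mem_fixedUnitStabilizer_glued_rep_iff hϖ0 hϖ1' ρ t hg V hV huT).1 hu
    have hu0 : ∀ i, ((u i : Kˣ) : K) ≠ 0 := fun i => (u i).ne_zero
    -- the coordinates `x = u₀`, `p = u₁∕u₀`, `y = u₂∕u₁`
    set x : K := ((u 0 : Kˣ) : K) with hx
    set y : K := ((u 2 : Kˣ) : K) / ((u 1 : Kˣ) : K) with hy
    set p : K := ((u 1 : Kˣ) : K) / ((u 0 : Kˣ) : K) with hp
    have hxσ : σ x = x := hu2 0
    have hx1 : Valued.v x = 1 := hu1 0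
    have hyσ : σ y = y := by rw [hy, map_div₀, hu2, hu2]
    have hy1 : Valued.v y = 1 := by rw [hy, map_div₀, hu1, hu1, div_one]
    have hy0 : y ≠ 0 := div_ne_zero (hu0 2) (hu0 1)
    have hyb : Valued.v (y - 1) ≤ Valued.v ϖ ^ (ρ + 2 * t) := by
      rw [hy, div_sub_one (hu0 1), map_div₀, hu1 1, div_one]; exact hb
    have hpσ : σ p = p := by rw [hp, map_div₀, hu2, hu2]
    have hp0 : p ≠ 0 := div_ne_zero (hu0 1) (hu0 0)
    have hpT : Valued.v (p * (y + g⁻¹ * (y - 1)) - 1) ≤ Valued.v ϖ ^ (2 * ρ) := by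
      have e : p * (y + g⁻¹ * (y - 1)) - 1 = (((u 0 : Kˣ) : K))⁻¹ * (g⁻¹ * (((u 2 : Kˣ) : K) - u 1) + (((u 2 : Kˣ) : K) - u 0)) := by
        rw [hp, hy]; field_simp; ring
      rw [e, map_mul, map_inv₀, hu1 0, inv_one, one_mul]; exact hc
    have hTy1 : Valued.v (y + g⁻¹ * (y - 1)) = 1 := v_eq_one_of_v_sub_one_lt_one ((v_T_sub_one_le hϖ0 hϖ1' ρ t hg hyb).trans_lt hρlt)
    have hTy0 : y + g⁻¹ * (y - 1) ≠ 0 := fun h0 => by rw [h0, map_zero] at hTy1; exact zero_ne_one hTy1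
    have hpT1 : Valued.v (p * (y + g⁻¹ * (y - 1))) = 1 := v_eq_one_of_v_sub_one_lt_one (hpT.trans_lt h2ρlt)
    -- represent `x`, then `y`
    obtain ⟨a₀, ⟨ha₀, e₀, he₀1, he₀⟩, ha₀u⟩ := hA₀ x hxσ hx1
    obtain ⟨aβ, ⟨haβ, s, hs1, hs⟩, haβu⟩ := hAβ y hyσ hyb
    have hs1' : Valued.v s = 1 := v_eq_one_of_v_sub_one_lt_one (hs1.trans_lt h2ρ2tlt)
    have hsN : Valued.v (s * σ s - 1) ≤ Valued.v ϖ ^ (2 * ρ + 2 * t) := v_mul_map_sub_one_le hvσ h2ρ2tlt hs1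
    -- `p′ = p·T(aβ) ∈ U^{[2ρ]}`
    have haβy : Valued.v (aβ - y) ≤ Valued.v ϖ ^ (2 * ρ + 2 * t) := by
      have e : aβ - y = y * (s * σ s - 1) := by rw [hs]; field_simp
      rw [e, map_mul, hy1, one_mul]; exact hsN
    have hTT : Valued.v ((aβ + g⁻¹ * (aβ - 1)) / (y + g⁻¹ * (y - 1)) - 1) ≤ Valued.v ϖ ^ (2 * ρ) := by
      rw [div_sub_one hTy0, map_div₀, hTy1, div_one]
      exact v_T_sub_T_le hϖ0 hϖ1' ρ t hg haβy
    set p' : K := p * (aβ + g⁻¹ * (aβ - 1)) with hp'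
    have hp'σ : σ p' = p' := by rw [hp', map_mul, hpσ, hTσ aβ haβ]
    have hp'1 : Valued.v (p' - 1) ≤ Valued.v ϖ ^ (2 * ρ) := by
      have e : p' = (p * (y + g⁻¹ * (y - 1))) * ((aβ + g⁻¹ * (aβ - 1)) / (y + g⁻¹ * (y - 1))) := by
        rw [hp', mul_assoc, ← mul_div_assoc, mul_div_cancel_left₀ _ hTy0]
      rw [e]; exact v_mul_sub_one_le hpT1.le hpT hTT
    have hp'0 : p' ≠ 0 := mul_ne_zero hp0 (hT0 aβ haβ)
    -- represent `p′`
    obtain ⟨aγ, ⟨haγ, w, hw1, hw⟩, haγu⟩ := hAγ p' hp'σ hp'1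
    have hw1' : Valued.v w = 1 := v_eq_one_of_v_sub_one_lt_one (hw1.trans_lt h2ρlt)
    -- the representative `r = a₀·(1, ψ, ψ·aβ)`
    have he₀0 : e₀ ≠ 0 := fun h0 => by rw [h0, map_zero] at he₀1; exact zero_ne_one he₀1
    have hw0 : w ≠ 0 := fun h0 => by rw [h0, map_zero] at hw1'; exact zero_ne_one hw1'
    have hs0 : s ≠ 0 := fun h0 => by rw [h0, map_zero] at hs1'; exact zero_ne_one hs1'
    have hψ0 : aγ * (aβ + g⁻¹ * (aβ - 1))⁻¹ ≠ 0 := mul_ne_zero (hAγ0 aγ haγ) (inv_ne_zero (hT0 aβ haβ))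
    let r : Fin 3 → Kˣ := ![Units.mk0 a₀ (hA₀0 a₀ ha₀), Units.mk0 (a₀ * (aγ * (aβ + g⁻¹ * (aβ - 1))⁻¹)) (mul_ne_zero (hA₀0 a₀ ha₀) hψ0),
      Units.mk0 (a₀ * (aγ * (aβ + g⁻¹ * (aβ - 1))⁻¹) * aβ) (mul_ne_zero (mul_ne_zero (hA₀0 a₀ ha₀) hψ0) (hAβ0 aβ haβ))]
    have hr0 : ((r 0 : Kˣ) : K) = a₀ := rfl
    have hr1 : ((r 1 : Kˣ) : K) = a₀ * (aγ * (aβ + g⁻¹ * (aβ - 1))⁻¹) := rfl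
    have hr2 : ((r 2 : Kˣ) : K) = a₀ * (aγ * (aβ + g⁻¹ * (aβ - 1))⁻¹) * aβ := rfl
    have hrR : r ∈ R₀ := (hR₀ r).2 ⟨a₀, ha₀, aβ, haβ, aγ, haγ, hr0, hr1, hr2⟩
    -- the norm witness `sv = (e₀, e₀w, e₀ws) ∈ D`
    let sv : Fin 3 → Kˣ := ![Units.mk0 e₀ he₀0, Units.mk0 (e₀ * w) (mul_ne_zero he₀0 hw0), Units.mk0 (e₀ * w * s) (mul_ne_zero (mul_ne_zero he₀0 hw0) hs0)]
    have hsv0 : ((sv 0 : Kˣ) : K) = e₀ := rfl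
    have hsv1 : ((sv 1 : Kˣ) : K) = e₀ * w := rfl
    have hsv2 : ((sv 2 : Kˣ) : K) = e₀ * w * s := rfl
    have hsvD : sv ∈ D := by
      refine (hD sv).2 ⟨fun i => ?_, ?_, ?_⟩
      · fin_cases i
        · show Valued.v ((sv 0 : Kˣ) : K) = 1
          rw [hsv0]; exact he₀1
        · show Valued.v ((sv 1 : Kˣ) : K) = 1
          rw [hsv1, map_mul, he₀1, hw1', mul_one]
        · show Valued.v ((sv 2 : Kˣ) : K) = 1
          rw [hsv2, map_mul, map_mul, he₀1, hw1', hs1', mul_one, mul_one]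
      · rw [hsv1, hsv0, show e₀ * w - e₀ = e₀ * (w - 1) by ring, map_mul, he₀1, one_mul]; exact hw1
      · rw [hsv2, hsv1, show e₀ * w * s - e₀ * w = e₀ * w * (s - 1) by ring, map_mul, map_mul, he₀1, hw1', one_mul, one_mul]; exact hs1
    have hN : unitNormMap σ 3 sv = u⁻¹ * r := by
      funext i
      apply Units.ext
      rw [unitNormMap_apply, Pi.mul_apply, Pi.inv_apply, Units.val_mul, Units.val_inv_eq_inv_val]
      fin_cases i
      · show e₀ * σ e₀ = (((u 0 : Kˣ) : K))⁻¹ * a₀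
        rw [he₀, hx, div_eq_mul_inv, mul_comm]
      · show e₀ * w * σ (e₀ * w) = (((u 1 : Kˣ) : K))⁻¹ * (a₀ * (aγ * (aβ + g⁻¹ * (aβ - 1))⁻¹))
        rw [map_mul, show e₀ * w * (σ e₀ * σ w) = (e₀ * σ e₀) * (w * σ w) by ring, he₀, hw, hp', hp, hx]
        field_simp [hTg aβ haβ]
      · show e₀ * w * s * σ (e₀ * w * s) = (((u 2 : Kˣ) : K))⁻¹ * (a₀ * (aγ * (aβ + g⁻¹ * (aβ - 1))⁻¹) * aβ)
        rw [map_mul, map_mul, show e₀ * w * s * (σ e₀ * σ w * σ s) = (e₀ * σ e₀) * (w * σ w) * (s * σ s) by ring, he₀, hw, hs, hp', hp, hx, hy]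
        field_simp [hTg aβ haβ]
    refine ⟨r, ⟨hrR, Subgroup.mem_map.2 ⟨sv, hsvD, hN⟩⟩, ?_⟩
    -- uniqueness
    rintro r' ⟨hr'R, hr'N⟩
    obtain ⟨a₀', ha₀', aβ', haβ', aγ', haγ', hr'0, hr'1, hr'2⟩ := (hR₀ r').1 hr'R
    obtain ⟨sv', hsv'D, hN'⟩ := Subgroup.mem_map.1 hr'N
    obtain ⟨hsv'1, hsv'a, hsv'b⟩ := (hD sv').1 hsv'D
    have hsv'0 : ∀ i, ((sv' i : Kˣ) : K) ≠ 0 := fun i => (sv' i).ne_zero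
    have hco : ∀ i, ((sv' i : Kˣ) : K) * σ ((sv' i : Kˣ) : K) = (((u i : Kˣ) : K))⁻¹ * ((r' i : Kˣ) : K) := fun i => by
      have := congrArg (fun f : Fin 3 → Kˣ => ((f i : Kˣ) : K)) hN'
      simpa only [unitNormMap_apply, Pi.mul_apply, Pi.inv_apply, Units.val_mul, Units.val_inv_eq_inv_val] using this
    -- coordinate `0`: `a₀′ = a₀`
    have ha₀e : a₀' = a₀ := ha₀u a₀' ⟨ha₀', ((sv' 0 : Kˣ) : K), hsv'1 0, by rw [hco 0, hr'0, hx, div_eq_mul_inv, mul_comm]⟩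
    -- coordinate `2∕1`: `aβ′ = aβ`
    have hψ'0 : aγ' * (aβ' + g⁻¹ * (aβ' - 1))⁻¹ ≠ 0 := mul_ne_zero (hAγ0 aγ' haγ') (inv_ne_zero (hT0 aβ' haβ'))
    have haβe : aβ' = aβ := by
      refine haβu aβ' ⟨haβ', ((sv' 2 : Kˣ) : K) / ((sv' 1 : Kˣ) : K), ?_, ?_⟩
      · rw [div_sub_one (hsv'0 1), map_div₀, hsv'1 1, div_one]; exact hsv'b
      · rw [map_div₀, show ((sv' 2 : Kˣ) : K) / ((sv' 1 : Kˣ) : K) * (σ ((sv' 2 : Kˣ) : K) / σ ((sv' 1 : Kˣ) : K)) =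
            (((sv' 2 : Kˣ) : K) * σ ((sv' 2 : Kˣ) : K)) / (((sv' 1 : Kˣ) : K) * σ ((sv' 1 : Kˣ) : K)) by ring, hco 2, hco 1, hr'2, hr'1, hy]
        field_simp [hA₀0 a₀' ha₀', hAγ0 aγ' haγ', hTg aβ' haβ']
    -- coordinate `1∕0`: `aγ′ = aγ`
    have haγe : aγ' = aγ := by
      refine haγu aγ' ⟨haγ', ((sv' 1 : Kˣ) : K) / ((sv' 0 : Kˣ) : K), ?_, ?_⟩
      · rw [div_sub_one (hsv'0 0), map_div₀, hsv'1 0, div_one]; exact hsv'a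
      · rw [map_div₀, show ((sv' 1 : Kˣ) : K) / ((sv' 0 : Kˣ) : K) * (σ ((sv' 1 : Kˣ) : K) / σ ((sv' 0 : Kˣ) : K)) =
            (((sv' 1 : Kˣ) : K) * σ ((sv' 1 : Kˣ) : K)) / (((sv' 0 : Kˣ) : K) * σ ((sv' 0 : Kˣ) : K)) by ring, hco 1, hco 0, hr'1, hr'0, haβe, hp', hp]
        field_simp [hA₀0 a₀' ha₀', hTg aβ haβ]
    -- hence `r′ = r`
    funext i
    apply Units.ext
    fin_cases i
    · show ((r' 0 : Kˣ) : K) = ((r 0 : Kˣ) : K)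
      rw [hr'0, hr0, ha₀e]
    · show ((r' 1 : Kˣ) : K) = ((r 1 : Kˣ) : K)
      rw [hr'1, hr1, ha₀e, haβe, haγe]
    · show ((r' 2 : Kˣ) : K) = ((r 2 : Kˣ) : K)
      rw [hr'2, hr2, ha₀e, haβe, haγe]

/-! ## §2 Existence and cardinality of the product transversal -/

/-- **(PT-4) THE PRODUCT FINSET `R₀` EXISTS AND HAS `#A₀·#Aβ·#Aγ` ELEMENTS** — the `Finset.image` of `A₀ ×ˢ Aβ ×ˢ Aγ` under `(a₀, aβ, aγ) ↦ a₀·(1, ψ, ψ·aβ)`,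
`ψ = aγ·(aβ + g⁻¹(aβ − 1))⁻¹`, the parametrisation being injective (`a₀ = r₀`, `aβ = r₂∕r₁`, `aγ = (r₁∕r₀)·T(aβ)`).  Only the valuative sizes of the three systems are used
(`|a₀| = 1`, `|aβ − 1| ≤ |ϖ|^{ρ+2t}`, `|aγ − 1| ≤ |ϖ|^{2ρ}`, making every coordinate a unit). [cite: Kottwitz1986BaseChangeUnits, §1 pp. 240–241] -/
theorem exists_productTransversal {ϖ : K} (hϖ0 : ϖ ≠ 0) (hϖ1 : Valued.v ϖ < 1) {ρ t : ℕ} (hρ : 1 ≤ ρ) {g : K} (hg : Valued.v g = Valued.v ϖ ^ (2 * t))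
    (A₀ Aβ Aγ : Finset K) (hA₀1 : ∀ a ∈ A₀, Valued.v a = 1) (hAγ1 : ∀ a ∈ Aγ, Valued.v (a - 1) ≤ Valued.v ϖ ^ (2 * ρ))
    (hAβ1 : ∀ a ∈ Aβ, Valued.v (a - 1) ≤ Valued.v ϖ ^ (ρ + 2 * t)) :
    ∃ R₀ : Finset (Fin 3 → Kˣ), (∀ r : Fin 3 → Kˣ, r ∈ R₀ ↔ ∃ a₀ ∈ A₀, ∃ aβ ∈ Aβ, ∃ aγ ∈ Aγ,
      (r 0 : K) = a₀ ∧ (r 1 : K) = a₀ * (aγ * (aβ + g⁻¹ * (aβ - 1))⁻¹) ∧ (r 2 : K) = a₀ * (aγ * (aβ + g⁻¹ * (aβ - 1))⁻¹) * aβ) ∧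
      R₀.card = A₀.card * Aβ.card * Aγ.card := by
  classical
  have hϖ1' : Valued.v ϖ ≤ 1 := hϖ1.le
  have hρlt : Valued.v ϖ ^ ρ < 1 := v_pow_lt_one hϖ1 (by omega)
  have h2ρlt : Valued.v ϖ ^ (2 * ρ) < 1 := v_pow_lt_one hϖ1 (by omega)
  have hρ2tlt : Valued.v ϖ ^ (ρ + 2 * t) < 1 := v_pow_lt_one hϖ1 (by omega)
  have hA₀0 : ∀ a ∈ A₀, a ≠ 0 := fun a ha h0 => by
    have := hA₀1 a ha; rw [h0, map_zero] at this; exact zero_ne_one this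
  have hAγ0 : ∀ a ∈ Aγ, a ≠ 0 := fun a ha h0 => by
    have := v_eq_one_of_v_sub_one_lt_one ((hAγ1 a ha).trans_lt h2ρlt); rw [h0, map_zero] at this; exact zero_ne_one this
  have hAβ0 : ∀ a ∈ Aβ, a ≠ 0 := fun a ha h0 => by
    have := v_eq_one_of_v_sub_one_lt_one ((hAβ1 a ha).trans_lt hρ2tlt); rw [h0, map_zero] at this; exact zero_ne_one this
  have hT0 : ∀ a ∈ Aβ, a + g⁻¹ * (a - 1) ≠ 0 := fun a ha h0 => by
    have := v_eq_one_of_v_sub_one_lt_one ((v_T_sub_one_le hϖ0 hϖ1' ρ t hg (hAβ1 a ha)).trans_lt hρlt)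
    rw [h0, map_zero] at this; exact zero_ne_one this
  have hψ0 : ∀ aβ ∈ Aβ, ∀ aγ ∈ Aγ, aγ * (aβ + g⁻¹ * (aβ - 1))⁻¹ ≠ 0 := fun aβ haβ aγ haγ =>
    mul_ne_zero (hAγ0 aγ haγ) (inv_ne_zero (hT0 aβ haβ))
  -- a total `K → Kˣ` section agreeing with `Units.mk0` off `0`
  let toU : K → Kˣ := fun c => if h : c = 0 then 1 else Units.mk0 c h
  have toU_val : ∀ c : K, c ≠ 0 → ((toU c : Kˣ) : K) = c := fun c hc => by
    simp only [toU, dif_neg hc, Units.val_mk0]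
  let F : K × K × K → (Fin 3 → Kˣ) := fun a =>
    ![toU a.1, toU (a.1 * (a.2.2 * (a.2.1 + g⁻¹ * (a.2.1 - 1))⁻¹)), toU (a.1 * (a.2.2 * (a.2.1 + g⁻¹ * (a.2.1 - 1))⁻¹) * a.2.1)]
  have hF0 : ∀ a : K × K × K, ((F a 0 : Kˣ) : K) = ((toU a.1 : Kˣ) : K) := fun a => rfl
  have hF1 : ∀ a : K × K × K, ((F a 1 : Kˣ) : K) = ((toU (a.1 * (a.2.2 * (a.2.1 + g⁻¹ * (a.2.1 - 1))⁻¹)) : Kˣ) : K) := fun a => rfl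
  have hF2 : ∀ a : K × K × K, ((F a 2 : Kˣ) : K) = ((toU (a.1 * (a.2.2 * (a.2.1 + g⁻¹ * (a.2.1 - 1))⁻¹) * a.2.1) : Kˣ) : K) := fun a => rfl
  -- values on the product
  have hv0 : ∀ a₀ ∈ A₀, ∀ aβ ∈ Aβ, ∀ aγ ∈ Aγ, ((F (a₀, aβ, aγ) 0 : Kˣ) : K) = a₀ := fun a₀ ha₀ aβ haβ aγ haγ => by
    rw [hF0]; exact toU_val _ (hA₀0 a₀ ha₀)
  have hv1 : ∀ a₀ ∈ A₀, ∀ aβ ∈ Aβ, ∀ aγ ∈ Aγ, ((F (a₀, aβ, aγ) 1 : Kˣ) : K) = a₀ * (aγ * (aβ + g⁻¹ * (aβ - 1))⁻¹) :=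
    fun a₀ ha₀ aβ haβ aγ haγ => by rw [hF1]; exact toU_val _ (mul_ne_zero (hA₀0 a₀ ha₀) (hψ0 aβ haβ aγ haγ))
  have hv2 : ∀ a₀ ∈ A₀, ∀ aβ ∈ Aβ, ∀ aγ ∈ Aγ, ((F (a₀, aβ, aγ) 2 : Kˣ) : K) = a₀ * (aγ * (aβ + g⁻¹ * (aβ - 1))⁻¹) * aβ :=
    fun a₀ ha₀ aβ haβ aγ haγ => by rw [hF2]; exact toU_val _ (mul_ne_zero (mul_ne_zero (hA₀0 a₀ ha₀) (hψ0 aβ haβ aγ haγ)) (hAβ0 aβ haβ))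
  refine ⟨(A₀ ×ˢ Aβ ×ˢ Aγ).image F, fun r => ?_, ?_⟩
  · rw [Finset.mem_image]
    constructor
    · rintro ⟨⟨a₀, aβ, aγ⟩, ha, rfl⟩
      simp only [Finset.mem_product] at ha
      obtain ⟨ha₀, haβ, haγ⟩ := ha
      exact ⟨a₀, ha₀, aβ, haβ, aγ, haγ, hv0 a₀ ha₀ aβ haβ aγ haγ, hv1 a₀ ha₀ aβ haβ aγ haγ, hv2 a₀ ha₀ aβ haβ aγ haγ⟩
    · rintro ⟨a₀, ha₀, aβ, haβ, aγ, haγ, h0, h1, h2⟩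
      refine ⟨(a₀, aβ, aγ), by simp only [Finset.mem_product]; exact ⟨ha₀, haβ, haγ⟩, ?_⟩
      funext i
      apply Units.ext
      fin_cases i
      · show ((F (a₀, aβ, aγ) 0 : Kˣ) : K) = ((r 0 : Kˣ) : K)
        rw [hv0 a₀ ha₀ aβ haβ aγ haγ, h0]
      · show ((F (a₀, aβ, aγ) 1 : Kˣ) : K) = ((r 1 : Kˣ) : K)
        rw [hv1 a₀ ha₀ aβ haβ aγ haγ, h1]
      · show ((F (a₀, aβ, aγ) 2 : Kˣ) : K) = ((r 2 : Kˣ) : K)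
        rw [hv2 a₀ ha₀ aβ haβ aγ haγ, h2]
  · rw [Finset.card_image_of_injOn, Finset.card_product, Finset.card_product, ← mul_assoc]
    rintro ⟨a₀, aβ, aγ⟩ ha ⟨a₀', aβ', aγ'⟩ ha' hF
    simp only [Finset.coe_product, Set.mem_prod, Finset.mem_coe] at ha ha'
    obtain ⟨ha₀, haβ, haγ⟩ := ha
    obtain ⟨ha₀', haβ', haγ'⟩ := ha'
    have e0 : a₀ = a₀' := by
      have := congrArg (fun f : Fin 3 → Kˣ => ((f 0 : Kˣ) : K)) hF
      simpa only [hv0 a₀ ha₀ aβ haβ aγ haγ, hv0 a₀' ha₀' aβ' haβ' aγ' haγ'] using this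
    have e1 : a₀ * (aγ * (aβ + g⁻¹ * (aβ - 1))⁻¹) = a₀' * (aγ' * (aβ' + g⁻¹ * (aβ' - 1))⁻¹) := by
      have := congrArg (fun f : Fin 3 → Kˣ => ((f 1 : Kˣ) : K)) hF
      simpa only [hv1 a₀ ha₀ aβ haβ aγ haγ, hv1 a₀' ha₀' aβ' haβ' aγ' haγ'] using this
    have e2 : a₀ * (aγ * (aβ + g⁻¹ * (aβ - 1))⁻¹) * aβ = a₀' * (aγ' * (aβ' + g⁻¹ * (aβ' - 1))⁻¹) * aβ' := by
      have := congrArg (fun f : Fin 3 → Kˣ => ((f 2 : Kˣ) : K)) hF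
      simpa only [hv2 a₀ ha₀ aβ haβ aγ haγ, hv2 a₀' ha₀' aβ' haβ' aγ' haγ'] using this
    have hψa : a₀ * (aγ * (aβ + g⁻¹ * (aβ - 1))⁻¹) ≠ 0 := mul_ne_zero (hA₀0 a₀ ha₀) (hψ0 aβ haβ aγ haγ)
    have eβ : aβ = aβ' := by
      rw [e1] at e2
      exact mul_left_cancel₀ (e1 ▸ hψa) e2
    have eγ : aγ = aγ' := by
      rw [e0, ← eβ] at e1
      have h1 := mul_left_cancel₀ (hA₀0 a₀' ha₀') e1
      exact mul_right_cancel₀ (inv_ne_zero (hT0 aβ haβ)) h1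
    rw [e0, eβ, eγ]

end Summit.HodgeConjecture.HodgeConjecture.Cruxes.H413.F0P3cDyRamGluedProductTransversal

end
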